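import Summits.CriticalPhenomena.PercolationContinuityZ3.Theorems.Transplant.SkelFrmBChoiceReadNums
import Summits.CriticalPhenomena.PercolationContinuityZ3.Theorems.Transplant.SkelFrmBChoiceRadiiT
import Summits.CriticalPhenomena.PercolationContinuityZ3.Theorems.Transplant.SkelFrmBChoiceDepth
import HarnessLib

/-!
(R-40) `…T` TWIN (stmt-g21, 2026-08-23; ruling p3-g16 06:23:56Z, J18; lead g11 06:35:07Z: the choice function of record moves to `frmChoiceAllQ3T`): the twin of
`SkelFrmBChoiceDepth` over the PER-AXIS-capped staggered cells `NegB.fcellsT : PCells2T` / the column slot `offNT` / the schedule `schedOfT` / the scheme `ΓQT` / the choices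
`choiceAtQ3T` (SkelFrmBChoiceDefsT); statements and proofs VERBATIM with the S ↦ T tokens of record (stmt's table + hp-8 g42's registry renamedT.txt); the CELL-FREE
declarations of `SkelFrmBChoiceDepth` are NOT re-declared (they serve the T function as landed — `SkelFrmBChoiceDepth` is imported); NO landed file is edited.

# N2 (frames-only node `SamePDropOfSkeletonFrm₁`, OPEN) — (ζ″) ledger, THE (C) DEPTH ROW `hRD` (x-corridor) at the tuple of record: the prism box's total reach
# `(N+1)·n_L + Z₀ + Z₁ ≤ 20K·n_L + 5·n_L + 18·sL` (SkelFrmBChoiceReadNums) turned into p5-g16's depth row (SkelPhiCorridorKGRoomsQ :185, `kq := 10`)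
# **`hRD_QT : (cOffS·‖y‖₁ + 1) + 13·((N+1)n_L + Z₀ + Z₁) ≤ rQ a y`** at the schedule of record `schedOfT … c (SUS ex mx …)`, under the residual floor
# **`hexD : 13·(20K·n_L + 5·n_L + 18·⌊sL⌋₊) + 1 ≤ ex`** (`depth_row_UT`, SkelFrmBChoiceRadii) and `‖y‖₁ ≤ nQ a y`.
builds on p205010 (kernel theorem, internal audit signed; external expert review pending) — nothing in this file uses p205010; NOTHING is claimed about the open
node `SamePDropOfSkeletonFrm₁`.
Lane `prim-bschramm`, seat `prim-bschramm-stmt` (gen 20); helper file (`--supports stmt-CriticalPhenomena-4575 --as helper`); ledger HOME/prim-bschramm-stmt/FRM-PARAMS.md.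
[cite: KozmaNitzan2024, §4 Lemma 12 (pp. 23–25)] [cite: MartineauTassion2017, §4.3 Lemma 4.2]
-/

open scoped Classical

noncomputable section

namespace Summit.CriticalPhenomena.PercolationContinuityZ3.Theorems.Transplant

namespace PlanarSkeletonFrm

namespace NegB

open Literature.Probability.Percolation Literature.Probability.LatticeModels SimpleGraph
open SkelConc (Consts)
open BoxProdZ2 (nQ)
open Skelφ (kgSL kgZ₀ kgZ₁ kgM₁ kgM₂ kgWm₂ kgWp₂)
open Neg

section Depth

variable (κ : Consts) {V : Type} [DecidableEq V] [Countable V] {G : SimpleGraph V} [G.LocallyFinite] (Φ : PlanarSkeletonFrm G) (t : V) (p : unitInterval)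
  (D : Skelφ.StepI.DataNS V) (g f mk : ℕ) (c : Fin 2 → ℕ) (ex mx : GSlot) (q : unitInterval)

-- (cell-free, not re-declared: `ZD` of SkelFrmBChoiceDepth)

-- (cell-free, not re-declared: `reach_le_ZD` of SkelFrmBChoiceDepth)

/-- **THE DEPTH ROW `hRD` at the tuple of record**: `(cOffS·‖y‖₁ + 1) + 13·((N+1)n_L + Z₀ + Z₁) ≤ rQ a y` for the schedule of record, under the residual floor
`ZD + 1 ≤ ex` and `‖y‖₁ ≤ nQ a y`. [this work] -/
theorem hRD_QT (hN : EqNumL κ Φ t p D g f) (hg : gFloorKG κ Φ t p D mk ≤ g) (hg2 : 40 * Neg.K κ * KS0.R'0 κ Φ t p D mk ≤ g)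
    (hexD : ZD κ Φ t p D g f + 1 ≤ ex κ Φ t p D g f) (a : ℕ) (y : Site 2) (hy : (y 0).natAbs + (y 1).natAbs ≤ nQ a y) :
    ((cOffS κ Φ t p D g f * ((y 0).natAbs + (y 1).natAbs) + 1 : ℕ) : ℤ) +
      13 * ((((kgNv0 κ Φ t p D g f mk (qxQ κ Φ t p D g f) (WxQ κ Φ t p D g f) : ℕ) : ℤ) + 1) * (nL κ Φ t p D g f : ℤ) +
      kgZ₀ (nL κ Φ t p D g f) (vL κ Φ t p D g f) (kgR κ Φ t p D mk) 0 (kgq κ Φ t p D g f (qxQ κ Φ t p D g f))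
        (kgNv0 κ Φ t p D g f mk (qxQ κ Φ t p D g f) (WxQ κ Φ t p D g f))
        (kgM₁ (nL κ Φ t p D g f) (ℓL κ Φ t p D g f) (hL κ Φ t p D g f) (kgR κ Φ t p D mk) 0 (kgW κ Φ t p D g f (WxQ κ Φ t p D g f))
          (kgNv0 κ Φ t p D g f mk (qxQ κ Φ t p D g f) (WxQ κ Φ t p D g f)))
        (kgM₂ (nL κ Φ t p D g f) (ℓL κ Φ t p D g f) (hL κ Φ t p D g f) (vL κ Φ t p D g f) (kgR κ Φ t p D mk) 0
          (kgq κ Φ t p D g f (qxQ κ Φ t p D g f)) (kgW κ Φ t p D g f (WxQ κ Φ t p D g f)) (kgNv0 κ Φ t p D g f mk (qxQ κ Φ t p D g f) (WxQ κ Φ t p D g f))) +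
      kgZ₁ (nL κ Φ t p D g f) (ℓL κ Φ t p D g f) (hL κ Φ t p D g f) (kgR κ Φ t p D mk) 0 (kgW κ Φ t p D g f (WxQ κ Φ t p D g f))
        (kgNv0 κ Φ t p D g f mk (qxQ κ Φ t p D g f) (WxQ κ Φ t p D g f))
        (kgM₁ (nL κ Φ t p D g f) (ℓL κ Φ t p D g f) (hL κ Φ t p D g f) (kgR κ Φ t p D mk) 0 (kgW κ Φ t p D g f (WxQ κ Φ t p D g f))
          (kgNv0 κ Φ t p D g f mk (qxQ κ Φ t p D g f) (WxQ κ Φ t p D g f)))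
        (kgWm₂ (nL κ Φ t p D g f) (ℓL κ Φ t p D g f) (hL κ Φ t p D g f) (kgR κ Φ t p D mk) 0 (kgW κ Φ t p D g f (WxQ κ Φ t p D g f))
          (kgNv0 κ Φ t p D g f mk (qxQ κ Φ t p D g f) (WxQ κ Φ t p D g f)))
        (kgWp₂ (nL κ Φ t p D g f) (ℓL κ Φ t p D g f) (hL κ Φ t p D g f) (kgR κ Φ t p D mk) 0 (kgW κ Φ t p D g f (WxQ κ Φ t p D g f))
          (kgNv0 κ Φ t p D g f mk (qxQ κ Φ t p D g f) (WxQ κ Φ t p D g f)))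
        (kgM₂ (nL κ Φ t p D g f) (ℓL κ Φ t p D g f) (hL κ Φ t p D g f) (vL κ Φ t p D g f) (kgR κ Φ t p D mk) 0
          (kgq κ Φ t p D g f (qxQ κ Φ t p D g f)) (kgW κ Φ t p D g f (WxQ κ Φ t p D g f)) (kgNv0 κ Φ t p D g f mk (qxQ κ Φ t p D g f) (WxQ κ Φ t p D g f))))
      ≤ (((schedOfT κ Φ t p D g f c (SUS ex mx κ Φ t p D g f q)).rQ a y : ℕ) : ℤ) := by
  have h1 := depth_row_UT κ Φ t p D g f c ex mx q a y hy hexD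
  have h2 := reach_le_ZD κ Φ t p D g f mk hN hg hg2
  have h3 : ((cOffS κ Φ t p D g f * ((y 0).natAbs + (y 1).natAbs) + 1 + ZD κ Φ t p D g f : ℕ) : ℤ) ≤
      (((schedOfT κ Φ t p D g f c (SUS ex mx κ Φ t p D g f q)).rQ a y : ℕ) : ℤ) := by exact_mod_cast h1
  push_cast at h3 ⊢
  linarith

end Depth

end NegB

end PlanarSkeletonFrm

end Summit.CriticalPhenomena.PercolationContinuityZ3.Theorems.Transplant

end
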